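import Literature.MathematicalPhysics.QuantumFieldTheory.Balaban1983to89.B11Eq117TransformationNorm

/-!
# `Balaban1983to89.B11Eq117TransformationNormComp` — T. Bałaban, *The variational problem and background fields in renormalization group method for
# lattice gauge theories*, Commun. Math. Phys. **102** (1985) 277–309 [Balaban1985Variational] (117) p. 295 *«By Theorem 3.13 of [5] the norm
# max{|·|_{(−1)}, |∇·|_{(−2)}} of the transformation can be estimated by B₀|J|_{(−3)} + …»* with [5] = [Balaban1985BackgroundPropagators] Thm 3.13 p. 426, Thm 3.1
# (3.42) p. 397 (BOTH entries): **THE NORM OF A TRANSFORMATION `|·|_(−3) → (115)` FROM TWO sup → sup BOUNDS — one for the map of functions `T`, ONE FOR THE COMPOSITE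
# `∇ ∘ T` — instead of the product `M_∇·M_T` of `B11Eq117TransformationNorm.norm_toCLM115_le`** (whose `M_∇ = 2|η|⁻¹`, `norm_nabla115_le`, costs the height
# `L^{n+1}` at the tower): `‖toCLM115 ∇ T‖ ≤ max(w̄₀·M_T, w̄₁·M_{∇T})·w̲⁻¹` — the socket through which a HEIGHT-FREE pair of letters `‖Tf‖_∞ ≤ B‖f‖_∞`,
# `‖∇(Tf)‖_∞ ≤ B‖f‖_∞` (the pub-balaban NE9 crew's `B9Eq347G1kSupGradGlobal.exists_global_supGrad_G1k` for `G₁,k`: [5] (3.47) for the value AND the covariant gradient)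
# becomes a height-free (117) constant; NE9 owner INTENT-8 gen 96

statement-level skeleton of published theorems with citation tags; proofs where landed; nothing here is a claim about the Yang–Mills mass gap

PDF held: `paper:balaban1985-cmp102-variational-background` (journal page = PDF page + 276), p. 295 (117), read through the verbatim quotation of
`B11Eq117TransformationNorm` (this lineage, gen 81).  [5] Thm 3.13 p. 426 ∕ (3.42) p. 397 through the pub-balaban NE9 crew's audited headers.

WHY THIS FILE (cell context).  `B11Eq117TransformationNorm.norm_toCLM115_le` bounds the (117) «norm of the transformation» by `max(w̄₀, w̄₁M_∇)·M_T·w̲⁻¹` with a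
sup→sup bound `M_∇` of the bare derivative letter — on a lattice of spacing `η` only `M_∇ = 2|η|⁻¹` is available (`norm_nabla115_le`), which is NOT uniform in the
height of the NE9 crew's tower (`|η|⁻¹ = L^{n+1}`).  Print's uniform `B₀` comes from Thm 3.13's SECOND row (the covariant gradient of `𝔊f` decays with the SAME
exponential letter), i.e. from a bound on the COMPOSITE `∇ ∘ T`.  This file is the three-line reading of (115)'s `max` that takes the composite bound as the datum.

WHAT IS PROVED (sorry-free; [folklore] finite-dimensional norm bookkeeping; no `Prop` placeholder; no inequality of the paper asserted).
* `norm_jetSymm_le_of_pair` — `‖A‖_(115) ≤ max(w̄₀·M₀, w̄₁·M₁)` from `‖A‖_∞ ≤ M₀` and `‖∇A‖_∞ ≤ M₁` (`JetSup.norm_le_iff`, `NegSup.norm_le_wSup_mul`).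
* **`norm_toCLM115_apply_le_of_comp`** ∕ **`norm_toCLM115_le_of_comp`** — for `T : (ι → V) →ₗ (ι → V)` with `‖Tg‖ ≤ M_T‖g‖` and `‖∇(Tg)‖ ≤ M_{∇T}‖g‖`:
  `‖toCLM115 ∇ T f‖ ≤ max(w̄₀·M_T, w̄₁·M_{∇T})·w̲⁻¹·‖f‖` and the operator-norm form (`w̲⁻¹` the largest inverse input weight, `NegSup.sup_norm_le_wInvSup_mul`).
MODEL ∕ HONEST SCOPE.  Finite index sets; the constants are finite-lattice numbers (extreme weights) times the two DISPLAYED letters `M_T`, `M_{∇T}` — nothing of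
print's `B₀` is valued; the instance `T := G₁,k` ∕ `𝔊̃_k` read on `𝔸`-valued functions (the carrier bridge `WL2` ↔ `NegSup`, prices `M_φ, M_φ′`) is NOT here.  NOT
summit progress (cell pub-balaban: NE9 NOT PRINTED ∕ NOT PROVED; «NE9 ⇐ the named binders»; row WALLED ON A MODEL (O-NE9-1; #5 UNRULED); spine PROVED 0∕9; rung (B)+1 on
a finite T⁴ — NOT infinite volume, NOT mass gap, NOT BetaPertH, NOT Clay; HONEST DEPENDENCY: continuum YM on T⁴ ⇐ BetaPertH ∧ nine spine estimates (0/9 proved); BetaPertH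
⇐ (D1) ∧ (D4) ∧ CAP+tail; G-an2-4 gates asym, D1 and NE2/3/4).  Filed by the pub-balaban NE9 BINDER-row owner lineage `b2b-balaban-t4-ne9-p1` (gen 96); NEW file
importing `B11Eq117TransformationNorm` only; nothing modified.  Net new unproved facts: 0.
-/

noncomputable section

namespace Literature.MathematicalPhysics.QuantumFieldTheory.Balaban1983to89.B11Eq117TransformationNormComp

open B11Eq115Space B11Eq111FrakG

variable {ι κ : Type*} [Fintype ι] [Fintype κ] {V : Type*} [NormedAddCommGroup V] [NormedSpace ℂ V] [FiniteDimensional ℂ V]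
  {L η : ℝ} [Fact (0 < L)] [Fact (0 < η)] {lev₀ : ι → ℕ}

omit [FiniteDimensional ℂ V] in
/-- **`‖A‖_(115) ≤ max(w̄₀·M₀, w̄₁·M₁)`** from a sup bound `M₀` of the configuration and a sup bound `M₁` of ITS derivative `∇A` (not of the derivative letter):
the two members of (115)'s `max`, each against its largest weight. [cite: Balaban1985Variational, (115) p.294, (117) p.295] -/
theorem norm_jetSymm_le_of_pair (lev₁ : κ → ℕ) (Dc : (ι → V) →ₗ[ℂ] (κ → V)) (h : ι → V) {M₀ M₁ : ℝ} (h0 : ‖h‖ ≤ M₀) (h1 : ‖Dc h‖ ≤ M₁) :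
    ‖(jetLinearEquiv L η lev₀ lev₁ Dc).symm h‖ ≤
      max ((NegSup.wSup (levWeight L η lev₀ 1) : ℝ) * M₀) (NegSup.wSup (levWeight L η lev₁ 2) * M₁) := by
  have e : JetSup.equiv _ _ Dc ((jetLinearEquiv L η lev₀ lev₁ Dc).symm h) = h :=
    (jetLinearEquiv L η lev₀ lev₁ Dc).apply_symm_apply h
  refine (JetSup.norm_le_iff (𝕜 := ℂ) (w₀ := levWeight L η lev₀ 1) (w₁ := levWeight L η lev₁ 2) (D := Dc)).2 ⟨?_, ?_⟩
  · have h2 := NegSup.norm_le_wSup_mul (JetSup.fst ((jetLinearEquiv L η lev₀ lev₁ Dc).symm h))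
    rw [JetSup.equiv_fst, e] at h2
    exact (h2.trans (mul_le_mul_of_nonneg_left h0 (NegSup.wSup (levWeight L η lev₀ 1)).coe_nonneg)).trans (le_max_left _ _)
  · have h2 := NegSup.norm_le_wSup_mul (JetSup.snd ((jetLinearEquiv L η lev₀ lev₁ Dc).symm h))
    rw [JetSup.equiv_snd, e] at h2
    exact (h2.trans (mul_le_mul_of_nonneg_left h1 (NegSup.wSup (levWeight L η lev₁ 2)).coe_nonneg)).trans (le_max_right _ _)

/-- **THE NORM OF A TRANSFORMATION `|·|_(−3) → (115)` FROM THE PAIR OF LETTERS `M_T`, `M_{∇T}`**, pointwise form: with `‖Tg‖ ≤ M_T‖g‖` and the COMPOSITE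
bound `‖∇(Tg)‖ ≤ M_{∇T}‖g‖` (print's two rows of [5] Thm 3.13 for `𝔊`), `‖toCLM115 ∇ T f‖ ≤ max(w̄₀·M_T, w̄₁·M_{∇T})·w̲⁻¹·‖f‖` — no `M_∇` of the bare
derivative enters. [cite: Balaban1985Variational, (117) p.295; Balaban1985BackgroundPropagators, Thm 3.13 p.426, Thm 3.1 (3.42) p.397] -/
theorem norm_toCLM115_apply_le_of_comp (lev₁ : κ → ℕ) (Dc : (ι → V) →ₗ[ℂ] (κ → V)) (T : (ι → V) →ₗ[ℂ] (ι → V)) {MT MDT : ℝ} (hMT : 0 ≤ MT)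
    (hMDT : 0 ≤ MDT) (hT : ∀ g, ‖T g‖ ≤ MT * ‖g‖) (hDT : ∀ g, ‖Dc (T g)‖ ≤ MDT * ‖g‖) (f : NegSize L η lev₀ 3 V) :
    ‖toCLM115 (L := L) (η := η) (lev₀ := lev₀) lev₁ Dc T f‖ ≤
      max ((NegSup.wSup (levWeight L η lev₀ 1) : ℝ) * MT) (NegSup.wSup (levWeight L η lev₁ 2) * MDT) * NegSup.wInvSup (levWeight L η lev₀ 3) * ‖f‖ := by
  have h0 : toCLM115 (L := L) (η := η) (lev₀ := lev₀) lev₁ Dc T f =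
      (jetLinearEquiv L η lev₀ lev₁ Dc).symm (T (NegSup.equiv _ V f)) := rfl
  rw [h0]
  set X : ℝ := (NegSup.wInvSup (levWeight L η lev₀ 3) : ℝ) * ‖f‖ with hX
  have hX0 : 0 ≤ X := mul_nonneg (NegSup.wInvSup (levWeight L η lev₀ 3)).coe_nonneg (norm_nonneg _)
  have hg : ‖NegSup.equiv _ V f‖ ≤ X := NegSup.sup_norm_le_wInvSup_mul f
  have hT' : ‖T (NegSup.equiv _ V f)‖ ≤ MT * X := (hT _).trans (mul_le_mul_of_nonneg_left hg hMT)
  have hDT' : ‖Dc (T (NegSup.equiv _ V f))‖ ≤ MDT * X := (hDT _).trans (mul_le_mul_of_nonneg_left hg hMDT)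
  refine (norm_jetSymm_le_of_pair lev₁ Dc _ hT' hDT').trans ?_
  have hw₀ : 0 ≤ (NegSup.wSup (levWeight L η lev₀ 1) : ℝ) := (NegSup.wSup (levWeight L η lev₀ 1)).coe_nonneg
  have hw₁ : 0 ≤ (NegSup.wSup (levWeight L η lev₁ 2) : ℝ) := (NegSup.wSup (levWeight L η lev₁ 2)).coe_nonneg
  have e : max ((NegSup.wSup (levWeight L η lev₀ 1) : ℝ) * MT) (NegSup.wSup (levWeight L η lev₁ 2) * MDT) * NegSup.wInvSup (levWeight L η lev₀ 3) * ‖f‖ =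
      max ((NegSup.wSup (levWeight L η lev₀ 1) : ℝ) * MT) (NegSup.wSup (levWeight L η lev₁ 2) * MDT) * X := by rw [hX]; ring
  rw [e]
  refine max_le ?_ ?_
  · calc (NegSup.wSup (levWeight L η lev₀ 1) : ℝ) * (MT * X) = (NegSup.wSup (levWeight L η lev₀ 1) : ℝ) * MT * X := by ring
      _ ≤ _ := mul_le_mul_of_nonneg_right (le_max_left _ _) hX0
  · calc (NegSup.wSup (levWeight L η lev₁ 2) : ℝ) * (MDT * X) = (NegSup.wSup (levWeight L η lev₁ 2) : ℝ) * MDT * X := by ring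
      _ ≤ _ := mul_le_mul_of_nonneg_right (le_max_right _ _) hX0

/-- **THE NORM OF A TRANSFORMATION `|·|_(−3) → (115)` FROM THE PAIR OF LETTERS**, operator-norm form: `‖toCLM115 ∇ T‖ ≤ max(w̄₀·M_T, w̄₁·M_{∇T})·w̲⁻¹` — the
height-free socket for (117)'s «norm of the transformation» once `M_T`, `M_{∇T}` are height-free ([5] (3.47) for both rows).
[cite: Balaban1985Variational, (117) p.295; Balaban1985BackgroundPropagators, Thm 3.13 p.426] -/
theorem norm_toCLM115_le_of_comp (lev₁ : κ → ℕ) (Dc : (ι → V) →ₗ[ℂ] (κ → V)) (T : (ι → V) →ₗ[ℂ] (ι → V)) {MT MDT : ℝ} (hMT : 0 ≤ MT)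
    (hMDT : 0 ≤ MDT) (hT : ∀ g, ‖T g‖ ≤ MT * ‖g‖) (hDT : ∀ g, ‖Dc (T g)‖ ≤ MDT * ‖g‖) :
    ‖toCLM115 (L := L) (η := η) (lev₀ := lev₀) lev₁ Dc T‖ ≤
      max ((NegSup.wSup (levWeight L η lev₀ 1) : ℝ) * MT) (NegSup.wSup (levWeight L η lev₁ 2) * MDT) * NegSup.wInvSup (levWeight L η lev₀ 3) := by
  refine ContinuousLinearMap.opNorm_le_bound _ ?_ (norm_toCLM115_apply_le_of_comp lev₁ Dc T hMT hMDT hT hDT)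
  exact mul_nonneg (le_max_of_le_left (mul_nonneg (NegSup.wSup (levWeight L η lev₀ 1)).coe_nonneg hMT)) (NegSup.wInvSup (levWeight L η lev₀ 3)).coe_nonneg

end Literature.MathematicalPhysics.QuantumFieldTheory.Balaban1983to89.B11Eq117TransformationNormComp

end
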